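import Literature.MathematicalPhysics.QuantumFieldTheory.ONArchipelagoDual
import Literature.MathematicalPhysics.QuantumFieldTheory.ConformalBootstrap3D.MixedCertificateObligations
import HarnessLib

/-!
# Obligations of an `O(N)` archipelago point certificate, and the `V`-sector bridge to the `σ–ε` odd sector

Third file of the archipelago rung (`ONArchipelagoSystem.lean`: the typed axioms A1–A5 and
`ArchipelagoEnclosure` / `BoxExcluded`; `ONArchipelagoDual.lean`: the 7-vector `α⃗`, its forms,
`IsPositiveAt`, the exclusion theorem and `boxExcluded_of_pointFunctional`).  It plays the role of
`ConformalBootstrap3D/MixedCertificateObligations.lean` (first part) for the archipelago system: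

* the per-`(Δ, ℓ)` positivity predicates over ALL genuine blocks — `TensorPositive`, `AntiPositive`,
  `VectorPositive`, `SingletPositive` — and the external predicate `ExtPositive`;
* `ArchipelagoObligations α N A Q E₀`: the positivity conditions of Kos–Poland–Simmons-Duffin–Vichi
  2015, §2.2 (eq. (example)) on a box `Q` of `(Δ_φ, Δ_s)`, with every sector's spectrum split at a
  head threshold `E₀` into scalars `[Δ^*_X, E₀)` (the gap of the sector, `A : ArchipelagoGaps`),
  spinning rows `[ℓ+1, E₀)` and the tail `Δ ≥ E₀`; `ArchipelagoObligations.isPositiveAt` (the list IS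
  `IsPositiveAt` on `Q`) and `ArchipelagoObligations.boxExcluded` (for point 7-vectors: a discharged
  list is a certificate, `BoxExcluded N A Q`);
* the `V`-SECTOR BRIDGE: the 5-vector `toOdd α = (0, 0, α₅, α₆, α₇)` has
  `CrossingFunctional.oddForm (toOdd α) Δ_φ Δ_s = vectorForm α Δ_φ Δ_s` DEFINITIONALLY
  (`vectorForm_eq_oddForm`; both carry the ERRATUM placement of the spin-parity sign), hence
  `VectorPositive α ↔ OddPositive (toOdd α)` (`vectorPositive_iff_oddPositive`), and for point 7-vectors
  `toOdd (ofPoints z z̄ w) = CrossingFunctional.ofPoints z z̄ (oddWeights w)` (`toOdd_ofPoints`), so that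
  every odd-sector theorem of the `σ–ε` chain stated for `CrossingFunctional.ofPoints`
  (`MixedOddHead`, `MixedOddTail`, `MixedOddRadial*`, `oddPositive_ofPoints_of_termwise`, …) discharges
  `V`-rows of an archipelago certificate with `(Δ_σ, Δ_ε) ↦ (Δ_φ, Δ_s)` (`vectorPositive_ofPoints_iff`).

What this file does NOT contain: the head / tail / box tables themselves (the `T`, `A` rows are
two-sign rows in one `(0,0)` block — the shape of `ConformalBootstrap3D/TwoSignRows.lean`; the `S` rows
are `2×2` forms with two-sign entries; their termwise rules are the next files), any certificate, any
number of any model.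

Sources: F. Kos, D. Poland, D. Simmons-Duffin, A. Vichi, JHEP 11 (2015) 106, arXiv:1504.07997, §2.2
(bib key `KosPolandSimmonsDuffinVichi2015`); F. Kos, D. Poland, D. Simmons-Duffin, JHEP 11 (2014) 109,
§3.3 eq. (3.16) (`KosPolandSimmonsduffin2014`).
-/

namespace Literature.MathematicalPhysics.QuantumFieldTheory.ONArchipelagoSystem

open Set
open ConformalBootstrap3D (IsConformalBlock3D unitarityBound3D crossF CrossingFunctional pointFunctional
  pointFunctional_apply)

namespace ArchipelagoFunctional

/-! ### §1 Positivity at one `(Δ, ℓ)`, over all genuine blocks -/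

/-- `α⃗·V⃗_{T,Δ,ℓ} ≥ 0` for EVERY genuine block `g^{0,0}_{Δ,ℓ}` (source §2.2, the `T` line).
[cite: KosPolandSimmonsDuffinVichi2015, §2.2 (functional conditions)] -/
def TensorPositive (α : ArchipelagoFunctional) (N : ℕ) (Δφ Δ : ℝ) (ℓ : ℕ) : Prop :=
  ∀ g : ℝ → ℝ → ℝ, IsConformalBlock3D 0 0 Δ ℓ g → 0 ≤ α.tensorForm N Δφ g

/-- `α⃗·V⃗_{A,Δ,ℓ} ≥ 0` for every genuine block (source §2.2, the `A` line).
[cite: KosPolandSimmonsDuffinVichi2015, §2.2 (functional conditions)] -/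
def AntiPositive (α : ArchipelagoFunctional) (Δφ Δ : ℝ) (ℓ : ℕ) : Prop :=
  ∀ g : ℝ → ℝ → ℝ, IsConformalBlock3D 0 0 Δ ℓ g → 0 ≤ α.antiForm Δφ g

/-- `α⃗·V⃗_{V,Δ,ℓ} ≥ 0` for every pair of genuine blocks `g^{±Δ_φs,Δ_φs}_{Δ,ℓ}` (source §2.2, the `V`
line). [cite: KosPolandSimmonsDuffinVichi2015, §2.2 (functional conditions)] -/
def VectorPositive (α : ArchipelagoFunctional) (Δφ Δs Δ : ℝ) (ℓ : ℕ) : Prop :=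
  ∀ g₁ g₂ : ℝ → ℝ → ℝ, IsConformalBlock3D (Δφ - Δs) (Δφ - Δs) Δ ℓ g₁ →
    IsConformalBlock3D (-(Δφ - Δs)) (Δφ - Δs) Δ ℓ g₂ → 0 ≤ α.vectorForm Δφ Δs ℓ g₁ g₂

/-- `α⃗·V⃗_{S,Δ,ℓ} ⪰ 0` for every genuine block (source §2.2, the `S` line).
[cite: KosPolandSimmonsDuffinVichi2015, §2.2 (functional conditions)] -/
def SingletPositive (α : ArchipelagoFunctional) (Δφ Δs Δ : ℝ) (ℓ : ℕ) : Prop :=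
  ∀ g : ℝ → ℝ → ℝ, IsConformalBlock3D 0 0 Δ ℓ g → ∀ a b : ℝ, 0 ≤ α.singletForm Δφ Δs g a b

/-- The external form `⪰ 0` for every triple of genuine blocks of `s` (in `φ×φ`, `s×s`) and `φ` (in
`φ×s`) at `(Δ_φ, Δ_s)` (source §2.2, last line of eq. (example)).
[cite: KosPolandSimmonsDuffinVichi2015, §2.2 (OPE-coefficient symmetry)] -/
def ExtPositive (α : ArchipelagoFunctional) (Δφ Δs : ℝ) : Prop :=
  ∀ gs gφm gφp : ℝ → ℝ → ℝ, IsConformalBlock3D 0 0 Δs 0 gs →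
    IsConformalBlock3D (Δφ - Δs) (Δφ - Δs) Δφ 0 gφm → IsConformalBlock3D (-(Δφ - Δs)) (Δφ - Δs) Δφ 0 gφp →
      ∀ a b : ℝ, 0 ≤ α.extForm Δφ Δs gs gφm gφp a b

/-! ### §2 The `V`-sector bridge to the `σ–ε` odd sector -/

/-- The odd 5-vector of a 7-vector: `(0, 0, α₅, α₆, α₇)` as a `CrossingFunctional` of the `σ–ε` file.
[cite: KosPolandSimmonsduffin2014, §3.2 eq. (3.13)] -/
def toOdd (α : ArchipelagoFunctional) : CrossingFunctional :=
  ⟨0, 0, α.α₅, α.α₆, α.α₇⟩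

/-- **The bridge, definitionally**: `vectorForm α Δ_φ Δ_s ℓ g₁ g₂ = oddForm (toOdd α) Δ_φ Δ_s ℓ g₁ g₂` —
the `V` rows of the archipelago system ARE the odd rows of the `σ–ε` system with `(σ, ε) ↦ (φ, s)`
(same prefactor exponents `h`, `Δ_φ`; same ERRATUM placement of `(-1)^ℓ`). [cite: KosPolandSimmonsduffin2014, §3.2 eq. (3.13)] -/
theorem vectorForm_eq_oddForm (α : ArchipelagoFunctional) (Δφ Δs : ℝ) (ℓ : ℕ) (g₁ g₂ : ℝ → ℝ → ℝ) :
    α.vectorForm Δφ Δs ℓ g₁ g₂ = α.toOdd.oddForm Δφ Δs ℓ g₁ g₂ := rfl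

/-- Hence `VectorPositive α ↔ OddPositive (toOdd α)` at every `(Δ, ℓ)`.
[cite: KosPolandSimmonsduffin2014, §3.3 eq. (3.16)] -/
theorem vectorPositive_iff_oddPositive (α : ArchipelagoFunctional) (Δφ Δs Δ : ℝ) (ℓ : ℕ) :
    α.VectorPositive Δφ Δs Δ ℓ ↔ α.toOdd.OddPositive Δφ Δs Δ ℓ := Iff.rfl

/-- The odd weight table of a 7-row weight table: rows `4, 5, 6` (`α₅, α₆, α₇`) in the slots `2, 3, 4`
(`α³, α⁴, α⁵`), zero in the slots `0, 1`. [cite: KosPolandSimmonsduffin2014, §3.2 eq. (3.13)] -/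
def oddWeights {n : ℕ} (w : Fin 7 → Fin n → ℝ) : Fin 5 → Fin n → ℝ :=
  fun r k => if r.val = 2 then w 4 k else if r.val = 3 then w 5 k else if r.val = 4 then w 6 k else 0

/-- A point functional with zero weights is the zero functional. Elementary. [cite: HogervorstRychkov2013, §4.3] -/
theorem pointFunctional_zero_weights {n : ℕ} (z zb : Fin n → ℝ) :
    pointFunctional (fun _ : Fin n => (0 : ℝ)) z zb = 0 := by
  ext F
  simp [pointFunctional_apply]

/-- **The bridge for point 7-vectors**: `toOdd (ofPoints z z̄ w) = CrossingFunctional.ofPoints z z̄ (oddWeights w)`.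
[cite: HogervorstRychkov2013, §4.3] -/
theorem toOdd_ofPoints {n : ℕ} (z zb : Fin n → ℝ) (w : Fin 7 → Fin n → ℝ) :
    (ofPoints z zb w).toOdd = CrossingFunctional.ofPoints z zb (oddWeights w) := by
  have h0 : (fun k : Fin n => (0 : ℝ)) = oddWeights w 0 := by funext k; simp [oddWeights]
  have h1 : (fun k : Fin n => (0 : ℝ)) = oddWeights w 1 := by funext k; simp [oddWeights]
  have h2 : w 4 = oddWeights w 2 := by funext k; simp [oddWeights]
  have h3 : w 5 = oddWeights w 3 := by funext k; simp [oddWeights]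
  have h4 : w 6 = oddWeights w 4 := by funext k; simp [oddWeights]
  show (⟨0, 0, pointFunctional (w 4) z zb, pointFunctional (w 5) z zb, pointFunctional (w 6) z zb⟩ :
      CrossingFunctional) = ⟨pointFunctional (oddWeights w 0) z zb, pointFunctional (oddWeights w 1) z zb,
      pointFunctional (oddWeights w 2) z zb, pointFunctional (oddWeights w 3) z zb,
      pointFunctional (oddWeights w 4) z zb⟩
  rw [← h0, ← h1, ← h2, ← h3, ← h4, pointFunctional_zero_weights]

/-- **Reuse of the `σ–ε` odd-sector chain**: for a point 7-vector, `VectorPositive` at `(Δ, ℓ)` is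
literally `OddPositive` of the point 5-vector with the odd weight table — every theorem of
`MixedOddHead` / `MixedOddTail` / `MixedOddRadial*` concluding
`(CrossingFunctional.ofPoints z z̄ w').OddPositive Δ_σ Δ_ε Δ ℓ` discharges a `V`-row obligation with
`w' = oddWeights w`, `(Δ_σ, Δ_ε) = (Δ_φ, Δ_s)`. [cite: KosPolandSimmonsduffin2014, §3.3 eq. (3.16)] -/
theorem vectorPositive_ofPoints_iff {n : ℕ} (z zb : Fin n → ℝ) (w : Fin 7 → Fin n → ℝ) (Δφ Δs Δ : ℝ)
    (ℓ : ℕ) : (ofPoints z zb w).VectorPositive Δφ Δs Δ ℓ ↔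
      (CrossingFunctional.ofPoints z zb (oddWeights w)).OddPositive Δφ Δs Δ ℓ := by
  rw [vectorPositive_iff_oddPositive, toOdd_ofPoints]

end ArchipelagoFunctional

/-! ### §3 The obligation list of a certificate -/

/-- **The obligations of an archipelago certificate** for a 7-vector `α⃗`, the parameter `N`, the gaps
`A`, a box `Q` of `(Δ_φ, Δ_s)` and a head threshold `E₀` — `IsPositiveAt` with each sector's spectrum
split into light and heavy parts: (I) identity; (X) the external form; `T` (even spins): scalars
`max(Δ_T^*, 1/2) ≤ Δ < E₀`, spins `ℓ ≥ 2` on `[ℓ+1, E₀)`, tail `Δ ≥ E₀`; `A` (odd spins): `[ℓ+1, E₀)` and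
tail; `V` (all spins): scalars from `Δ_V^*`, every `ℓ ≥ 1` on `[ℓ+1, E₀)`, tail; `S` (even spins, `2×2`):
scalars from `Δ_S^*`, spins, tail. [cite: KosPolandSimmonsDuffinVichi2015, §2.2 (functional conditions)] -/
structure ArchipelagoObligations (α : ArchipelagoFunctional) (N : ℕ) (A : ArchipelagoGaps)
    (Q : Set (ℝ × ℝ)) (E₀ : ℝ) : Prop where
  /-- (I) the identity term is positive on `Q`. -/
  identity_pos : ∀ p ∈ Q, 0 < α.identityTerm p.1 p.2
  /-- (X) the external form (`s` and `φ`, OPE symmetry) is PSD on `Q`. -/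
  ext : ∀ p ∈ Q, α.ExtPositive p.1 p.2
  /-- (T3) traceless-symmetric scalars above the gap `Δ_T^*` (and the unitarity bound), below `E₀`. -/
  scalar_T : ∀ p ∈ Q, ∀ Δ : ℝ, A.ΔTstar ≤ Δ → 1 / 2 ≤ Δ → Δ < E₀ → α.TensorPositive N p.1 Δ 0
  /-- (T4) traceless-symmetric, even non-zero spins between the bound and `E₀`. -/
  spinning_T : ∀ p ∈ Q, ∀ ℓ : ℕ, Even ℓ → ℓ ≠ 0 → ∀ Δ : ℝ, (ℓ : ℝ) + 1 ≤ Δ → Δ < E₀ →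
    α.TensorPositive N p.1 Δ ℓ
  /-- (T5) traceless-symmetric tail: every even spin, `Δ ≥ E₀` above the unitarity bound. -/
  tail_T : ∀ p ∈ Q, ∀ ℓ : ℕ, Even ℓ → ∀ Δ : ℝ, unitarityBound3D ℓ ≤ Δ → E₀ ≤ Δ →
    α.TensorPositive N p.1 Δ ℓ
  /-- (A4) antisymmetric, odd spins between the bound and `E₀`. -/
  spinning_A : ∀ p ∈ Q, ∀ ℓ : ℕ, Odd ℓ → ∀ Δ : ℝ, (ℓ : ℝ) + 1 ≤ Δ → Δ < E₀ → α.AntiPositive p.1 Δ ℓ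
  /-- (A5) antisymmetric tail. -/
  tail_A : ∀ p ∈ Q, ∀ ℓ : ℕ, Odd ℓ → ∀ Δ : ℝ, unitarityBound3D ℓ ≤ Δ → E₀ ≤ Δ → α.AntiPositive p.1 Δ ℓ
  /-- (V3) vector scalars above the gap `Δ_V^*` (and the bound), below `E₀`. -/
  scalar_V : ∀ p ∈ Q, ∀ Δ : ℝ, A.ΔVstar ≤ Δ → 1 / 2 ≤ Δ → Δ < E₀ → α.VectorPositive p.1 p.2 Δ 0
  /-- (V4) vectors of every non-zero spin between the bound and `E₀`. -/
  spinning_V : ∀ p ∈ Q, ∀ ℓ : ℕ, ℓ ≠ 0 → ∀ Δ : ℝ, (ℓ : ℝ) + 1 ≤ Δ → Δ < E₀ →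
    α.VectorPositive p.1 p.2 Δ ℓ
  /-- (V5) vector tail: every spin. -/
  tail_V : ∀ p ∈ Q, ∀ ℓ : ℕ, ∀ Δ : ℝ, unitarityBound3D ℓ ≤ Δ → E₀ ≤ Δ → α.VectorPositive p.1 p.2 Δ ℓ
  /-- (S3) singlet scalars above the gap `Δ_S^*` (and the bound), below `E₀` (`2×2`). -/
  scalar_S : ∀ p ∈ Q, ∀ Δ : ℝ, A.ΔSstar ≤ Δ → 1 / 2 ≤ Δ → Δ < E₀ → α.SingletPositive p.1 p.2 Δ 0
  /-- (S4) singlets of even non-zero spin between the bound and `E₀`. -/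
  spinning_S : ∀ p ∈ Q, ∀ ℓ : ℕ, Even ℓ → ℓ ≠ 0 → ∀ Δ : ℝ, (ℓ : ℝ) + 1 ≤ Δ → Δ < E₀ →
    α.SingletPositive p.1 p.2 Δ ℓ
  /-- (S5) singlet tail. -/
  tail_S : ∀ p ∈ Q, ∀ ℓ : ℕ, Even ℓ → ∀ Δ : ℝ, unitarityBound3D ℓ ≤ Δ → E₀ ≤ Δ →
    α.SingletPositive p.1 p.2 Δ ℓ

namespace ArchipelagoObligations

variable {α : ArchipelagoFunctional} {N : ℕ} {A : ArchipelagoGaps} {Q : Set (ℝ × ℝ)} {E₀ : ℝ}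

/-- The obligation list is exactly `IsPositiveAt` against `A` at every point of `Q` (case split on
`Δ < E₀` and `ℓ = 0`; for `ℓ ≠ 0` the unitarity bound reads `ℓ + 1 ≤ Δ`, for `ℓ = 0` it reads
`1/2 ≤ Δ`). Elementary. [cite: KosPolandSimmonsDuffinVichi2015, §2.2 (functional conditions)] -/
theorem isPositiveAt (h : ArchipelagoObligations α N A Q E₀) : ∀ p ∈ Q, α.IsPositiveAt N A p.1 p.2 := by
  intro p hp
  have hb0 : unitarityBound3D 0 = 1 / 2 := by simp [unitarityBound3D]
  refine ⟨h.identity_pos p hp, ?_, ?_, ?_, ?_, h.ext p hp⟩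
  · intro Δ ℓ g hℓ hb hgap hg
    rcases lt_or_ge Δ E₀ with hlt | hge
    · by_cases h0 : ℓ = 0
      · subst h0
        rw [hb0] at hb
        exact h.scalar_T p hp Δ (hgap rfl) hb hlt g hg
      · have hb' : (ℓ : ℝ) + 1 ≤ Δ := by simpa [unitarityBound3D, h0] using hb
        exact h.spinning_T p hp ℓ hℓ h0 Δ hb' hlt g hg
    · exact h.tail_T p hp ℓ hℓ Δ hb hge g hg
  · intro Δ ℓ g hℓ hb hg
    rcases lt_or_ge Δ E₀ with hlt | hge
    · have h0 : ℓ ≠ 0 := fun h0 => by subst h0; exact (Nat.not_odd_iff_even.mpr (by decide)) hℓ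
      have hb' : (ℓ : ℝ) + 1 ≤ Δ := by simpa [unitarityBound3D, h0] using hb
      exact h.spinning_A p hp ℓ hℓ Δ hb' hlt g hg
    · exact h.tail_A p hp ℓ hℓ Δ hb hge g hg
  · intro Δ ℓ g₁ g₂ hb hgap hg₁ hg₂
    rcases lt_or_ge Δ E₀ with hlt | hge
    · by_cases h0 : ℓ = 0
      · subst h0
        rw [hb0] at hb
        exact h.scalar_V p hp Δ (hgap rfl) hb hlt g₁ g₂ hg₁ hg₂
      · have hb' : (ℓ : ℝ) + 1 ≤ Δ := by simpa [unitarityBound3D, h0] using hb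
        exact h.spinning_V p hp ℓ h0 Δ hb' hlt g₁ g₂ hg₁ hg₂
    · exact h.tail_V p hp ℓ Δ hb hge g₁ g₂ hg₁ hg₂
  · intro Δ ℓ g hℓ hb hgap hg a b
    rcases lt_or_ge Δ E₀ with hlt | hge
    · by_cases h0 : ℓ = 0
      · subst h0
        rw [hb0] at hb
        exact h.scalar_S p hp Δ (hgap rfl) hb hlt g hg a b
      · have hb' : (ℓ : ℝ) + 1 ≤ Δ := by simpa [unitarityBound3D, h0] using hb
        exact h.spinning_S p hp ℓ hℓ h0 Δ hb' hlt g hg a b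
    · exact h.tail_S p hp ℓ hℓ Δ hb hge g hg a b

/-- **A discharged obligation list is a certificate.** For a 7-vector of point-evaluation functionals
on common nodes in the open square, the obligations on `Q` give `BoxExcluded N A Q` (termwise action on
the seven sum rules is proved, `boxExcluded_of_pointFunctional`).
[cite: KosPolandSimmonsDuffinVichi2015, §2.2 (functional conditions)] -/
theorem boxExcluded {n : ℕ} {z zb : Fin n → ℝ} {w : Fin 7 → Fin n → ℝ}
    (hz : ∀ k, z k ∈ Ioo (0 : ℝ) 1) (hzb : ∀ k, zb k ∈ Ioo (0 : ℝ) 1)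
    (h : ArchipelagoObligations (ArchipelagoFunctional.ofPoints z zb w) N A Q E₀) : BoxExcluded N A Q :=
  ArchipelagoFunctional.boxExcluded_of_pointFunctional A z zb w hz hzb Q h.isPositiveAt

/-- Monotonicity of the list in the gaps: obligations against `A` imply obligations against any `A'`
with componentwise larger thresholds (fewer scalars to test). [cite: KosPolandSimmonsDuffinVichi2015, §2.2 (assumptions; eq. example)] -/
theorem of_le {A' : ArchipelagoGaps} (h : ArchipelagoObligations α N A Q E₀) (hS : A.ΔSstar ≤ A'.ΔSstar)
    (hV : A.ΔVstar ≤ A'.ΔVstar) (hT : A.ΔTstar ≤ A'.ΔTstar) : ArchipelagoObligations α N A' Q E₀ where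
  identity_pos := h.identity_pos
  ext := h.ext
  scalar_T := fun p hp Δ hΔ => h.scalar_T p hp Δ (hT.trans hΔ)
  spinning_T := h.spinning_T
  tail_T := h.tail_T
  spinning_A := h.spinning_A
  tail_A := h.tail_A
  scalar_V := fun p hp Δ hΔ => h.scalar_V p hp Δ (hV.trans hΔ)
  spinning_V := h.spinning_V
  tail_V := h.tail_V
  scalar_S := fun p hp Δ hΔ => h.scalar_S p hp Δ (hS.trans hΔ)
  spinning_S := h.spinning_S
  tail_S := h.tail_S

/-- A sub-box inherits the obligations. [cite: KosPolandSimmonsDuffinVichi2015, §2.2 (functional conditions)] -/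
theorem mono {Q' : Set (ℝ × ℝ)} (h : ArchipelagoObligations α N A Q E₀) (hQ : Q' ⊆ Q) :
    ArchipelagoObligations α N A Q' E₀ where
  identity_pos := fun p hp => h.identity_pos p (hQ hp)
  ext := fun p hp => h.ext p (hQ hp)
  scalar_T := fun p hp => h.scalar_T p (hQ hp)
  spinning_T := fun p hp => h.spinning_T p (hQ hp)
  tail_T := fun p hp => h.tail_T p (hQ hp)
  spinning_A := fun p hp => h.spinning_A p (hQ hp)
  tail_A := fun p hp => h.tail_A p (hQ hp)
  scalar_V := fun p hp => h.scalar_V p (hQ hp)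
  spinning_V := fun p hp => h.spinning_V p (hQ hp)
  tail_V := fun p hp => h.tail_V p (hQ hp)
  scalar_S := fun p hp => h.scalar_S p (hQ hp)
  spinning_S := fun p hp => h.spinning_S p (hQ hp)
  tail_S := fun p hp => h.tail_S p (hQ hp)

end ArchipelagoObligations

end Literature.MathematicalPhysics.QuantumFieldTheory.ONArchipelagoSystem
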